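import Literature.Topology.FourManifolds.ExportAlgebraAffine
import Mathlib.Analysis.Normed.Operator.ContinuousLinearMap
import HarnessLib

/-!
# Export algebra between a simplex and its faces, III: curved transitions (offsets)

Topic `Literature/Topology/FourManifolds`; sequel of `ExportAlgebraAffine.lean` (downward sweep of the
smoothing of PD homeomorphisms; Munkres, Ann. of Math. 72 (1960), §5; Campbell–D'Onofrio–Vítek (2026),
§4).  When the face `τ` and the coface `σ` are read in DIFFERENT smooth charts, the chart transitions
are curved; at a point `p` the true composite agrees to first order with the conjugate of `σ`'s stage
by the first-order Taylor maps of the transitions, which is of the affine form of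
`ExportAlgebraAffine` up to three OFFSETS: a constant `m₀ = M y₀ + J z₀` in the target fibre (the
target `σ`-wedge is curved: `τ`'s zero section is not exactly in it), a constant `c₁` in the
`σ`-fibre coordinate (apex mismatch: `τ`'s reading ray misses `σ`'s axis) and a small linear
dependence `C_E` of the `σ`-fibre coordinate on the `τ`-tangential variable.  So

  `N_τ q = m₀ + M q.2 + J (φ (a q, c₁ + C_E q.1 + C q.2))`,  `T_τ q = t₀ + q.1 + M_E q.2 + J_E (φ (…))`.

We re-derive the face's pointwise data with the offsets carried explicitly:

* `tauNormalOff_fibre_lower_bound` : `ν ((1 − Xβ) ‖M w‖ + c ‖C w‖) ≤ ‖D N_τ (0, w)‖` (unchanged);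
* `tauNormalOff_source_defect_le` : the source-form Euler defect `u` has `M u = −M y₀` and
  `c ‖C u‖ ≤ X ‖A (0, y)‖ + Y + X₄ ‖c₁ + C_E x‖ + ‖z₀‖ + X β ‖M y₀‖`;
* `tauNormalOff_kernel_slope` : `D N_τ (v, w) = 0 ⟹ c_τ ‖w‖ ≤ ‖J‖ (X ‖A (v, 0)‖ + X₄ ‖C_E v‖)`;
* `norm_fderiv_tauTangOff_inl_sub_le`, `norm_fderiv_tauTangOff_inr_le`, `norm_tauTangOff_sub_fst_le` :
  the flatten data `δ, C, D` of `T_τ` with offsets.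

Chain rule and norm bookkeeping; the only definitions are the explicit functions `tauNormalOff`,
`tauTangOff`; no named facts.

## References

* J. R. Munkres, *Obstructions to the smoothing of piecewise-differentiable homeomorphisms*, Ann.
  of Math. (2) 72 (1960), 521–554, §5. [Munkres1960]
* D. Campbell, L. D'Onofrio, T. Vítek, *Diffeomorphic approximation of piecewise affine
  homeomorphisms*, J. Geom. Anal. 36 (2026), §4. [CampbellDonofrioVitek2026]
-/

noncomputable section

open Set Function Metric Filter
open scoped Topology

namespace Literature.Topology.FourManifolds

variable {Eτ : Type*} [NormedAddCommGroup Eτ] [NormedSpace ℝ Eτ]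
variable {Eσ : Type*} [NormedAddCommGroup Eσ] [NormedSpace ℝ Eσ]
variable {Fτ : Type*} [NormedAddCommGroup Fτ] [NormedSpace ℝ Fτ]
variable {Fσ : Type*} [NormedAddCommGroup Fσ] [NormedSpace ℝ Fσ]
variable {Fτ' : Type*} [NormedAddCommGroup Fτ'] [NormedSpace ℝ Fτ']
variable {Fσ' : Type*} [NormedAddCommGroup Fσ'] [NormedSpace ℝ Fσ']

/-- The `σ`-fibre coordinate with offsets: `c₁ + C_E q.1 + C q.2`. [folklore] -/
def sigmaFibreOff (C : Fτ →L[ℝ] Fσ) (CE : Eτ →L[ℝ] Fσ) (c₁ : Fσ) (q : Eτ × Fτ) : Fσ :=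
  c₁ + CE q.1 + C q.2

/-- **The normal part seen by the face through curved transitions (first-order form with
offsets)**: `N_τ q = m₀ + M q.2 + J (φ (a q, c₁ + C_E q.1 + C q.2))`. [folklore] -/
def tauNormalOff (M : Fτ →L[ℝ] Fτ') (J : Fσ' →L[ℝ] Fτ') (a : Eτ × Fτ → Eσ) (C : Fτ →L[ℝ] Fσ)
    (CE : Eτ →L[ℝ] Fσ) (c₁ : Fσ) (m₀ : Fτ') (φ : Eσ × Fσ → Fσ') (q : Eτ × Fτ) : Fτ' :=
  m₀ + M q.2 + J (φ (a q, sigmaFibreOff C CE c₁ q))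

/-- **The tangential part with offsets**: `T_τ q = t₀ + q.1 + M_E q.2 + J_E (φ (a q, σ-fibre))`.
[folklore] -/
def tauTangOff (ME : Fτ →L[ℝ] Eτ) (JE : Fσ' →L[ℝ] Eτ) (a : Eτ × Fτ → Eσ) (C : Fτ →L[ℝ] Fσ)
    (CE : Eτ →L[ℝ] Fσ) (c₁ : Fσ) (t₀ : Eτ) (φ : Eσ × Fσ → Fσ') (q : Eτ × Fτ) : Eτ :=
  t₀ + q.1 + ME q.2 + JE (φ (a q, sigmaFibreOff C CE c₁ q))

variable {M : Fτ →L[ℝ] Fτ'} {J : Fσ' →L[ℝ] Fτ'} {ME : Fτ →L[ℝ] Eτ} {JE : Fσ' →L[ℝ] Eτ}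
  {a : Eτ × Fτ → Eσ} {A : (Eτ × Fτ) →L[ℝ] Eσ} {C : Fτ →L[ℝ] Fσ} {CE : Eτ →L[ℝ] Fσ} {c₁ : Fσ}
  {m₀ : Fτ'} {t₀ : Eτ} {φ : Eσ × Fσ → Fσ'} {p : Eτ × Fτ}

/-- The `σ`-point map `q ↦ (a q, σ-fibre q)` and its derivative. [folklore] -/
theorem hasFDerivAt_sigmaPointOff (ha : HasFDerivAt a A p) :
    HasFDerivAt (fun q : Eτ × Fτ => (a q, sigmaFibreOff C CE c₁ q))
      (A.prod (CE.comp (ContinuousLinearMap.fst ℝ Eτ Fτ) + C.comp (ContinuousLinearMap.snd ℝ Eτ Fτ))) p := by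
  refine ha.prodMk ?_
  have h1 : HasFDerivAt (fun q : Eτ × Fτ => CE q.1) (CE.comp (ContinuousLinearMap.fst ℝ Eτ Fτ)) p :=
    CE.hasFDerivAt.comp p hasFDerivAt_fst
  have h2 : HasFDerivAt (fun q : Eτ × Fτ => C q.2) (C.comp (ContinuousLinearMap.snd ℝ Eτ Fτ)) p :=
    C.hasFDerivAt.comp p hasFDerivAt_snd
  exact ((h1.add h2).const_add c₁).congr_of_eventuallyEq
    (Filter.Eventually.of_forall fun q => by simp only [sigmaFibreOff, add_assoc, Pi.add_apply])

/-- **Derivative of the offset normal part.** [folklore] -/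
theorem hasFDerivAt_tauNormalOff (ha : HasFDerivAt a A p)
    (hφ : DifferentiableAt ℝ φ (a p, sigmaFibreOff C CE c₁ p)) :
    HasFDerivAt (tauNormalOff M J a C CE c₁ m₀ φ)
      (M.comp (ContinuousLinearMap.snd ℝ Eτ Fτ) +
        J.comp ((fderiv ℝ φ (a p, sigmaFibreOff C CE c₁ p)).comp
          (A.prod (CE.comp (ContinuousLinearMap.fst ℝ Eτ Fτ) + C.comp (ContinuousLinearMap.snd ℝ Eτ Fτ))))) p := by
  have h1 : HasFDerivAt (fun q : Eτ × Fτ => M q.2) (M.comp (ContinuousLinearMap.snd ℝ Eτ Fτ)) p :=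
    M.hasFDerivAt.comp p hasFDerivAt_snd
  have h3 : HasFDerivAt (fun q : Eτ × Fτ => J (φ (a q, sigmaFibreOff C CE c₁ q)))
      (J.comp ((fderiv ℝ φ (a p, sigmaFibreOff C CE c₁ p)).comp
        (A.prod (CE.comp (ContinuousLinearMap.fst ℝ Eτ Fτ) + C.comp (ContinuousLinearMap.snd ℝ Eτ Fτ))))) p :=
    J.hasFDerivAt.comp p (hφ.hasFDerivAt.comp p (hasFDerivAt_sigmaPointOff (C := C) (CE := CE) (c₁ := c₁) ha))
  exact ((h1.add h3).const_add m₀).congr_of_eventuallyEq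
    (Filter.Eventually.of_forall fun q => by simp only [tauNormalOff, add_assoc, Pi.add_apply])

/-- `D N_τ (0, w) = M w + J (L (A (0, w), C w))`. [folklore] -/
theorem fderiv_tauNormalOff_apply_inr (ha : HasFDerivAt a A p)
    (hφ : DifferentiableAt ℝ φ (a p, sigmaFibreOff C CE c₁ p)) (w : Fτ) :
    fderiv ℝ (tauNormalOff M J a C CE c₁ m₀ φ) p (0, w) =
      M w + J (fderiv ℝ φ (a p, sigmaFibreOff C CE c₁ p) (A (0, w), C w)) := by
  rw [(hasFDerivAt_tauNormalOff ha hφ).fderiv]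
  simp

/-- `D N_τ (v, 0) = J (L (A (v, 0), C_E v))`. [folklore] -/
theorem fderiv_tauNormalOff_apply_inl (ha : HasFDerivAt a A p)
    (hφ : DifferentiableAt ℝ φ (a p, sigmaFibreOff C CE c₁ p)) (v : Eτ) :
    fderiv ℝ (tauNormalOff M J a C CE c₁ m₀ φ) p (v, 0) =
      J (fderiv ℝ φ (a p, sigmaFibreOff C CE c₁ p) (A (v, 0), CE v)) := by
  rw [(hasFDerivAt_tauNormalOff ha hφ).fderiv]
  simp

/-- **Derivative of the offset tangential part.** [folklore] -/
theorem hasFDerivAt_tauTangOff (ha : HasFDerivAt a A p)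
    (hφ : DifferentiableAt ℝ φ (a p, sigmaFibreOff C CE c₁ p)) :
    HasFDerivAt (tauTangOff ME JE a C CE c₁ t₀ φ)
      (ContinuousLinearMap.fst ℝ Eτ Fτ + ME.comp (ContinuousLinearMap.snd ℝ Eτ Fτ) +
        JE.comp ((fderiv ℝ φ (a p, sigmaFibreOff C CE c₁ p)).comp
          (A.prod (CE.comp (ContinuousLinearMap.fst ℝ Eτ Fτ) + C.comp (ContinuousLinearMap.snd ℝ Eτ Fτ))))) p := by
  have h1 : HasFDerivAt (fun q : Eτ × Fτ => ME q.2) (ME.comp (ContinuousLinearMap.snd ℝ Eτ Fτ)) p :=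
    ME.hasFDerivAt.comp p hasFDerivAt_snd
  have h3 : HasFDerivAt (fun q : Eτ × Fτ => JE (φ (a q, sigmaFibreOff C CE c₁ q)))
      (JE.comp ((fderiv ℝ φ (a p, sigmaFibreOff C CE c₁ p)).comp
        (A.prod (CE.comp (ContinuousLinearMap.fst ℝ Eτ Fτ) + C.comp (ContinuousLinearMap.snd ℝ Eτ Fτ))))) p :=
    JE.hasFDerivAt.comp p (hφ.hasFDerivAt.comp p (hasFDerivAt_sigmaPointOff (C := C) (CE := CE) (c₁ := c₁) ha))
  have h0 : HasFDerivAt (fun q : Eτ × Fτ => q.1) (ContinuousLinearMap.fst ℝ Eτ Fτ) p := hasFDerivAt_fst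
  exact (((h0.add h1).add h3).const_add t₀).congr_of_eventuallyEq
    (Filter.Eventually.of_forall fun q => by simp only [tauTangOff, add_assoc, Pi.add_apply])

/-- `D T_τ (v, 0) = v + J_E (L (A (v, 0), C_E v))`. [folklore] -/
theorem fderiv_tauTangOff_apply_inl (ha : HasFDerivAt a A p)
    (hφ : DifferentiableAt ℝ φ (a p, sigmaFibreOff C CE c₁ p)) (v : Eτ) :
    fderiv ℝ (tauTangOff ME JE a C CE c₁ t₀ φ) p (v, 0) =
      v + JE (fderiv ℝ φ (a p, sigmaFibreOff C CE c₁ p) (A (v, 0), CE v)) := by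
  rw [(hasFDerivAt_tauTangOff ha hφ).fderiv]
  simp

/-- `D T_τ (0, w) = M_E w + J_E (L (A (0, w), C w))`. [folklore] -/
theorem fderiv_tauTangOff_apply_inr (ha : HasFDerivAt a A p)
    (hφ : DifferentiableAt ℝ φ (a p, sigmaFibreOff C CE c₁ p)) (w : Fτ) :
    fderiv ℝ (tauTangOff ME JE a C CE c₁ t₀ φ) p (0, w) =
      ME w + JE (fderiv ℝ φ (a p, sigmaFibreOff C CE c₁ p) (A (0, w), C w)) := by
  rw [(hasFDerivAt_tauTangOff ha hφ).fderiv]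
  simp

section Geometry

variable {ν β : ℝ} (hν : ∀ (y : Fτ) (z : Fσ'), ν * (‖M y‖ + ‖z‖) ≤ ‖M y + J z‖)
  (hβ : ∀ w : Fτ, ‖A (0, w)‖ ≤ β * ‖M w‖)

include hν hβ in
/-- **(E2 for the face, with offsets)** — identical to the affine case: the offsets are constants.
[folklore] -/
theorem tauNormalOff_fibre_lower_bound (hν0 : 0 < ν) (ha : HasFDerivAt a A p)
    (hφ : DifferentiableAt ℝ φ (a p, sigmaFibreOff C CE c₁ p)) {c X : ℝ} (hX : 0 ≤ X)
    (hE1 : ∀ e : Eσ, ‖fderiv ℝ φ (a p, sigmaFibreOff C CE c₁ p) (e, 0)‖ ≤ X * ‖e‖)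
    (hE2 : ∀ z : Fσ, c * ‖z‖ ≤ ‖fderiv ℝ φ (a p, sigmaFibreOff C CE c₁ p) (0, z)‖) (w : Fτ) :
    ν * ((1 - X * β) * ‖M w‖ + c * ‖C w‖) ≤ ‖fderiv ℝ (tauNormalOff M J a C CE c₁ m₀ φ) p (0, w)‖ := by
  set L := fderiv ℝ φ (a p, sigmaFibreOff C CE c₁ p) with hL
  rw [fderiv_tauNormalOff_apply_inr ha hφ, ← hL]
  have h1 := hν w (L (A (0, w), C w))
  have h2 : c * ‖C w‖ - X * β * ‖M w‖ ≤ ‖L (A (0, w), C w)‖ := by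
    rw [map_prod_eq_add L]
    have h3 := hE2 (C w)
    have h5 : ‖L (A (0, w), 0)‖ ≤ X * β * ‖M w‖ := by
      refine (hE1 (A (0, w))).trans ?_
      rw [mul_assoc]; exact mul_le_mul_of_nonneg_left (hβ w) hX
    have h6 : ‖L (0, C w)‖ - ‖L (A (0, w), 0)‖ ≤ ‖L (A (0, w), 0) + L (0, C w)‖ := by
      have := norm_sub_le_norm_add (L (0, C w)) (L (A (0, w), 0))
      rw [add_comm] at this
      linarith
    linarith
  calc ν * ((1 - X * β) * ‖M w‖ + c * ‖C w‖) = ν * (‖M w‖ + (c * ‖C w‖ - X * β * ‖M w‖)) := by ring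
    _ ≤ ν * (‖M w‖ + ‖L (A (0, w), C w)‖) := by
        apply mul_le_mul_of_nonneg_left _ hν0.le
        linarith
    _ ≤ _ := h1

include hν hβ in
/-- **(E3 for the face, with offsets)** If `u` solves `D N_τ (0, u) = D N_τ (0, y) − N_τ p` and the
target offset decomposes as `m₀ = M y₀ + J z₀`, then `M u = −M y₀` and
`c ‖C u‖ ≤ X ‖A (0, y)‖ + Y + X₄ ‖c₁ + C_E x‖ + ‖z₀‖ + X β ‖M y₀‖`, where (E1), (E2) are as above,
(E3) `‖L (0, y_σ) − φ (a p, y_σ)‖ ≤ Y` at the actual `σ`-fibre coordinate `y_σ = c₁ + C_E x + C y`, and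
(E4) `‖L (0, z)‖ ≤ X₄ ‖z‖`. [folklore] -/
theorem tauNormalOff_source_defect_le (hν0 : 0 < ν) (ha : HasFDerivAt a A p)
    (hφ : DifferentiableAt ℝ φ (a p, sigmaFibreOff C CE c₁ p)) {c X X₄ Y : ℝ} (hX : 0 ≤ X)
    (hE1 : ∀ e : Eσ, ‖fderiv ℝ φ (a p, sigmaFibreOff C CE c₁ p) (e, 0)‖ ≤ X * ‖e‖)
    (hE2 : ∀ z : Fσ, c * ‖z‖ ≤ ‖fderiv ℝ φ (a p, sigmaFibreOff C CE c₁ p) (0, z)‖)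
    (hE3 : ‖fderiv ℝ φ (a p, sigmaFibreOff C CE c₁ p) (0, sigmaFibreOff C CE c₁ p) -
      φ (a p, sigmaFibreOff C CE c₁ p)‖ ≤ Y)
    (hE4 : ∀ z : Fσ, ‖fderiv ℝ φ (a p, sigmaFibreOff C CE c₁ p) (0, z)‖ ≤ X₄ * ‖z‖)
    {y₀ : Fτ} {z₀ : Fσ'} (hm₀ : m₀ = M y₀ + J z₀) {u : Fτ}
    (hu : fderiv ℝ (tauNormalOff M J a C CE c₁ m₀ φ) p (0, u) =
      fderiv ℝ (tauNormalOff M J a C CE c₁ m₀ φ) p (0, p.2) - tauNormalOff M J a C CE c₁ m₀ φ p) :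
    M u = -M y₀ ∧
      c * ‖C u‖ ≤ X * ‖A (0, p.2)‖ + Y + X₄ * ‖c₁ + CE p.1‖ + ‖z₀‖ + X * β * ‖M y₀‖ := by
  set L := fderiv ℝ φ (a p, sigmaFibreOff C CE c₁ p) with hL
  set yσ := sigmaFibreOff C CE c₁ p with hyσ
  rw [fderiv_tauNormalOff_apply_inr ha hφ, fderiv_tauNormalOff_apply_inr ha hφ, ← hL] at hu
  set zu := L (A (0, u), C u) with hzu
  -- the bracket `[L (A(0,y), 0) + (L (0, yσ) − φ) − L (0, c₁ + CE x)]`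
  set br := L (A (0, p.2), 0) + (L (0, yσ) - φ (a p, yσ)) - L (0, c₁ + CE p.1) with hbr
  have hCy : L (A (0, p.2), C p.2) - φ (a p, yσ) = br := by
    have e1 : C p.2 = yσ - (c₁ + CE p.1) := by
      rw [hyσ, sigmaFibreOff]; abel
    rw [map_prod_eq_add L, e1]
    have e2 : L (0, yσ - (c₁ + CE p.1)) = L (0, yσ) - L (0, c₁ + CE p.1) := by
      rw [← map_sub]; congr 1; ext <;> simp
    rw [e2, hbr]; abel
  -- the equation `M (u + y₀) + J (zu + z₀ − br) = 0`
  have heq : M (u + y₀) + J (zu + z₀ - br) = 0 := by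
    have h : M u + J zu = M p.2 + J (L (A (0, p.2), C p.2)) - tauNormalOff M J a C CE c₁ m₀ φ p := hu
    rw [tauNormalOff, ← hyσ, hm₀] at h
    have h' : M u + J zu = J (L (A (0, p.2), C p.2) - φ (a p, yσ)) - M y₀ - J z₀ := by
      rw [h, map_sub]; abel
    rw [hCy] at h'
    have e2 : M (u + y₀) + J (zu + z₀ - br) = (M u + J zu) + M y₀ + J z₀ - J br := by
      rw [map_add, map_sub, map_add]; abel
    rw [e2, h']
    abel
  obtain ⟨hMu, hz⟩ := eq_zero_of_add_eq_zero hν hν0 heq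
  have hMu' : M u = -M y₀ := by
    rw [map_add] at hMu; exact eq_neg_of_add_eq_zero_left hMu
  refine ⟨hMu', ?_⟩
  -- `zu = br − z₀` and `L (0, C u) = zu − L (A (0, u), 0)`
  have hzu_eq : zu = br - z₀ := eq_sub_of_add_eq (sub_eq_zero.1 hz)
  have hLCu : L (0, C u) = zu - L (A (0, u), 0) := by
    rw [hzu]; exact eq_sub_of_add_eq' (map_prod_eq_add L _ _).symm
  have hAu : ‖A (0, u)‖ ≤ β * ‖M y₀‖ := by
    have := hβ u; rwa [hMu', norm_neg] at this
  have hbr_le : ‖br‖ ≤ X * ‖A (0, p.2)‖ + Y + X₄ * ‖c₁ + CE p.1‖ := by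
    rw [hbr]
    calc ‖L (A (0, p.2), 0) + (L (0, yσ) - φ (a p, yσ)) - L (0, c₁ + CE p.1)‖
        ≤ ‖L (A (0, p.2), 0) + (L (0, yσ) - φ (a p, yσ))‖ + ‖L (0, c₁ + CE p.1)‖ := norm_sub_le _ _
      _ ≤ (‖L (A (0, p.2), 0)‖ + ‖L (0, yσ) - φ (a p, yσ)‖) + ‖L (0, c₁ + CE p.1)‖ :=
          add_le_add (norm_add_le _ _) le_rfl
      _ ≤ (X * ‖A (0, p.2)‖ + Y) + X₄ * ‖c₁ + CE p.1‖ := add_le_add (add_le_add (hE1 _) hE3) (hE4 _)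
      _ = _ := by ring
  calc c * ‖C u‖ ≤ ‖L (0, C u)‖ := hE2 (C u)
    _ = ‖zu - L (A (0, u), 0)‖ := by rw [hLCu]
    _ ≤ ‖zu‖ + ‖L (A (0, u), 0)‖ := norm_sub_le _ _
    _ ≤ (‖br‖ + ‖z₀‖) + X * (β * ‖M y₀‖) := by
        refine add_le_add ?_ ((hE1 _).trans (mul_le_mul_of_nonneg_left hAu hX))
        rw [hzu_eq]; exact norm_sub_le _ _
    _ ≤ (X * ‖A (0, p.2)‖ + Y + X₄ * ‖c₁ + CE p.1‖ + ‖z₀‖) + X * (β * ‖M y₀‖) := by linarith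
    _ = X * ‖A (0, p.2)‖ + Y + X₄ * ‖c₁ + CE p.1‖ + ‖z₀‖ + X * β * ‖M y₀‖ := by ring

end Geometry

/-- **(Kernel slope with offsets)** `D N_τ (v, w) = 0 ⟹ c_τ ‖w‖ ≤ ‖J‖ (X ‖A (v, 0)‖ + X₄ ‖C_E v‖)`
given the face's fibre lower bound `c_τ ‖w‖ ≤ ‖D N_τ (0, w)‖`, (E1) and (E4). [folklore] -/
theorem tauNormalOff_kernel_slope (ha : HasFDerivAt a A p)
    (hφ : DifferentiableAt ℝ φ (a p, sigmaFibreOff C CE c₁ p)) {X X₄ cτ : ℝ}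
    (hE1 : ∀ e : Eσ, ‖fderiv ℝ φ (a p, sigmaFibreOff C CE c₁ p) (e, 0)‖ ≤ X * ‖e‖)
    (hE4 : ∀ z : Fσ, ‖fderiv ℝ φ (a p, sigmaFibreOff C CE c₁ p) (0, z)‖ ≤ X₄ * ‖z‖)
    {v : Eτ} {w : Fτ} (hc : cτ * ‖w‖ ≤ ‖fderiv ℝ (tauNormalOff M J a C CE c₁ m₀ φ) p (0, w)‖)
    (h0 : fderiv ℝ (tauNormalOff M J a C CE c₁ m₀ φ) p (v, w) = 0) :
    cτ * ‖w‖ ≤ ‖J‖ * (X * ‖A (v, 0)‖ + X₄ * ‖CE v‖) := by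
  set L := fderiv ℝ φ (a p, sigmaFibreOff C CE c₁ p) with hL
  have hsplit : fderiv ℝ (tauNormalOff M J a C CE c₁ m₀ φ) p (v, w) =
      fderiv ℝ (tauNormalOff M J a C CE c₁ m₀ φ) p (v, 0) + fderiv ℝ (tauNormalOff M J a C CE c₁ m₀ φ) p (0, w) := by
    rw [← map_add]; congr 1; ext <;> simp
  rw [hsplit, fderiv_tauNormalOff_apply_inl ha hφ, ← hL] at h0
  have h1 : ‖fderiv ℝ (tauNormalOff M J a C CE c₁ m₀ φ) p (0, w)‖ = ‖J (L (A (v, 0), CE v))‖ := by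
    rw [← norm_neg, ← (neg_eq_of_add_eq_zero_right h0), neg_neg]
  calc cτ * ‖w‖ ≤ _ := hc
    _ = ‖J (L (A (v, 0), CE v))‖ := h1
    _ ≤ ‖J‖ * ‖L (A (v, 0), CE v)‖ := J.le_opNorm _
    _ ≤ ‖J‖ * (X * ‖A (v, 0)‖ + X₄ * ‖CE v‖) := by
        apply mul_le_mul_of_nonneg_left _ (norm_nonneg _)
        rw [map_prod_eq_add L]
        exact (norm_add_le _ _).trans (add_le_add (hE1 _) (hE4 _))

/-- **(Flatten datum `δ` with offsets)** `‖D T_τ (v, 0) − v‖ ≤ ‖J_E‖ (X ‖A (v, 0)‖ + X₄ ‖C_E v‖)`.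
[folklore] -/
theorem norm_fderiv_tauTangOff_inl_sub_le (ha : HasFDerivAt a A p)
    (hφ : DifferentiableAt ℝ φ (a p, sigmaFibreOff C CE c₁ p)) {X X₄ : ℝ}
    (hE1 : ∀ e : Eσ, ‖fderiv ℝ φ (a p, sigmaFibreOff C CE c₁ p) (e, 0)‖ ≤ X * ‖e‖)
    (hE4 : ∀ z : Fσ, ‖fderiv ℝ φ (a p, sigmaFibreOff C CE c₁ p) (0, z)‖ ≤ X₄ * ‖z‖) (v : Eτ) :
    ‖fderiv ℝ (tauTangOff ME JE a C CE c₁ t₀ φ) p (v, 0) - v‖ ≤ ‖JE‖ * (X * ‖A (v, 0)‖ + X₄ * ‖CE v‖) := by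
  rw [fderiv_tauTangOff_apply_inl ha hφ, add_sub_cancel_left]
  refine (JE.le_opNorm _).trans (mul_le_mul_of_nonneg_left ?_ (norm_nonneg _))
  rw [map_prod_eq_add (fderiv ℝ φ (a p, sigmaFibreOff C CE c₁ p))]
  exact (norm_add_le _ _).trans (add_le_add (hE1 _) (hE4 _))

/-- **(Flatten datum `C` with offsets)** `‖D T_τ (0, w)‖ ≤ ‖M_E w‖ + ‖J_E‖ (X ‖A (0, w)‖ + X₄ ‖C w‖)`.
[folklore] -/
theorem norm_fderiv_tauTangOff_inr_le (ha : HasFDerivAt a A p)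
    (hφ : DifferentiableAt ℝ φ (a p, sigmaFibreOff C CE c₁ p)) {X X₄ : ℝ}
    (hE1 : ∀ e : Eσ, ‖fderiv ℝ φ (a p, sigmaFibreOff C CE c₁ p) (e, 0)‖ ≤ X * ‖e‖)
    (hE4 : ∀ z : Fσ, ‖fderiv ℝ φ (a p, sigmaFibreOff C CE c₁ p) (0, z)‖ ≤ X₄ * ‖z‖) (w : Fτ) :
    ‖fderiv ℝ (tauTangOff ME JE a C CE c₁ t₀ φ) p (0, w)‖ ≤ ‖ME w‖ + ‖JE‖ * (X * ‖A (0, w)‖ + X₄ * ‖C w‖) := by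
  rw [fderiv_tauTangOff_apply_inr ha hφ]
  refine (norm_add_le _ _).trans (add_le_add le_rfl ?_)
  refine (JE.le_opNorm _).trans (mul_le_mul_of_nonneg_left ?_ (norm_nonneg _))
  rw [map_prod_eq_add (fderiv ℝ φ (a p, sigmaFibreOff C CE c₁ p))]
  exact (norm_add_le _ _).trans (add_le_add (hE1 _) (hE4 _))

omit [NormedAddCommGroup Eσ] [NormedSpace ℝ Eσ] in
/-- **(Flatten datum `D` with offsets)** `‖T_τ p − p.1‖ ≤ ‖t₀‖ + ‖M_E p.2‖ + ‖J_E‖ ‖φ (…)‖`.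
[folklore] -/
theorem norm_tauTangOff_sub_fst_le {Eσ : Type*} {a : Eτ × Fτ → Eσ} {φ : Eσ × Fσ → Fσ'} (p : Eτ × Fτ) :
    ‖tauTangOff ME JE a C CE c₁ t₀ φ p - p.1‖ ≤
      ‖t₀‖ + ‖ME p.2‖ + ‖JE‖ * ‖φ (a p, sigmaFibreOff C CE c₁ p)‖ := by
  rw [tauTangOff]
  have e : t₀ + p.1 + ME p.2 + JE (φ (a p, sigmaFibreOff C CE c₁ p)) - p.1 =
      t₀ + (ME p.2 + JE (φ (a p, sigmaFibreOff C CE c₁ p))) := by abel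
  rw [e]
  calc _ ≤ ‖t₀‖ + ‖ME p.2 + JE (φ (a p, sigmaFibreOff C CE c₁ p))‖ := norm_add_le _ _
    _ ≤ ‖t₀‖ + (‖ME p.2‖ + ‖JE‖ * ‖φ (a p, sigmaFibreOff C CE c₁ p)‖) :=
        add_le_add le_rfl ((norm_add_le _ _).trans (add_le_add le_rfl (JE.le_opNorm _)))
    _ = _ := by ring

end Literature.Topology.FourManifolds
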